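import Summits.CriticalPhenomena.SAWScalingLimit.Theorems.SAWDefectDecoherenceBoundaryClosureRGateStabilityKernel
import Summits.CriticalPhenomena.SAWScalingLimit.Theorems.SAWDefectDecoherenceBoundaryClosureRGateStabilityRoot
import Summits.CriticalPhenomena.SAWScalingLimit.Theorems.SAWDefectDecoherenceBoundaryClosureRIdentificationUniformiser
import Literature.Probability.RandomPlanarGeometry.CaratheodoryKernelPointwise
import HarnessLib

/-!
# `BoundaryClosureR` (stmt-CriticalPhenomena-14004), line `polygon-parity-squeeze`, stub
# `stub_gateStability` (GS), part V: identification of kernel limits on the gate disc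

The heart of the gate-stability theorem (Carathéodory kernel convergence of conformal gate
densities for inner domains pinned at both marked points).  Setting: a Dobrushin domain
`(Ω; a, b)` flat at `b = D.pt 1` inside `B = B(b, R₁)` and at `a = D.pt 0` inside `B₀ = B(a, R₀)`,
a frame `Φ : Ω → ℍₒ` (`a ↦ ∞`, `b ↦ 0`) with gate reflection `F` (holomorphic on `B`, `= Φ` on the
upper half-disc); inner Dobrushin domains `P_n ⊆ Ω` with the SAME flat pieces, exhausting the
compacts of `Ω`; frames `Φ_n` of the `P_n` with gate reflections `F_n` (univalent on `B`,
`F_n(b) = 0`, `F_n'(b) > 0`) and root reflections `h_n` (univalent on `B₀`, `h_n(a) = 0`,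
`h_n Φ_n = 1`).

* `kernel_limit_eq` — **every locally uniform subsequential limit `G̃` of `F_n / F_n'(b)` on `B`
  equals `F / F'(b)`.**  Proof: `G̃` is univalent, `G̃(b) = 0`, `G̃'(b) = 1`, `G̃(B⁺) ⊆ ℍₒ`
  (part IV); the rescaled inverse frames `ψ_n = Φ_n⁻¹(F_n'(b) ·) : ℍₒ → P_n ⊆ Ω` are bounded, so a
  further subsequence converges to a univalent `ψ̃ : ℍₒ → Ω` with `ψ̃ ∘ G̃ = id` on `B⁺` (Montel,
  Hurwitz, and the Jordan fencing lemma); `ψ̃` is ONTO `Ω` (local Montel limits of the rescaled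
  frames on thickened paths invert `ψ̃`); so `Φ̃ = ψ̃⁻¹ : Ω → ℍₒ` is a conformal equivalence extending
  `G̃|B⁺`, with `Φ̃ → 0` at `b`; AT THE ROOT, the univalent reciprocals `F_n'(b) h_n` and Koebe's
  theorems force `‖Φ̃‖ → ∞` (part III); hence `Φ̃ = λ Φ` (uniqueness of frames up to dilation,
  `Identification.uniformiser_unique`), `G̃ = λ F` on `B⁺`, so on `B`, and `λ = 1/F'(b)` from
  `G̃'(b) = 1`.

References: Pommerenke, *Boundary Behaviour of Conformal Maps* (1992), Thm. 1.8 (Carathéodory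
kernel theorem), Thm. 1.3 (Koebe distortion), Thm. 2.6 (Carathéodory).
-/

noncomputable section

open scoped Topology
open Filter Set Metric Complex Bornology Function
open UpperHalfPlane (upperHalfPlaneSet isOpen_upperHalfPlaneSet)
open Literature.Probability.RandomPlanarGeometry
open Summit.CriticalPhenomena.SAWScalingLimit.Theorems.PickHalfPlane

namespace Summit.CriticalPhenomena.SAWScalingLimit.Theorems.PolygonParitySqueeze.GateStability

/-- Under flatness `S ∩ B(c, R) = {im > im c} ∩ B(c, R)`, the upper half-disc lies in `S`.
[folklore] -/
theorem upperHalfDisc_subset_of_flat {S : Set ℂ} {c : ℂ} {R : ℝ}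
    (hflat : S ∩ ball c R = {z : ℂ | c.im < z.im} ∩ ball c R) :
    {z : ℂ | c.im < z.im} ∩ ball c R ⊆ S := fun z hz => by
  have : z ∈ S ∩ ball c R := by rw [hflat]; exact hz
  exact this.1

/-- The point `c + i t`, `0 < t < R`, lies in the upper half-disc `{im > im c} ∩ B(c, R)`.
[folklore] -/
theorem add_mul_I_mem_upperHalfDisc (c : ℂ) {R t : ℝ} (ht : 0 < t) (htR : t < R) :
    c + (t : ℂ) * I ∈ {z : ℂ | c.im < z.im} ∩ ball c R := by
  refine ⟨?_, ?_⟩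
  · show c.im < (c + (t : ℂ) * I).im
    simp [ht]
  · rw [mem_ball, dist_eq_norm, add_sub_cancel_left, norm_mul, norm_real, norm_I, mul_one,
      Real.norm_of_nonneg ht.le]
    exact htR

/-- **Identification of kernel limits on the gate disc** (see the module docstring for the
setting and the proof). [cite: PommerenkeBBCM1992, Thm. 1.8] -/
theorem kernel_limit_eq (D : DobrushinDomain) {R₁ R₀ : ℝ} (hR₁ : 0 < R₁) (hR₀ : 0 < R₀)
    (hflat1 : D.carrier ∩ ball (D.pt 1) R₁ = {z : ℂ | (D.pt 1).im < z.im} ∩ ball (D.pt 1) R₁)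
    (hflat0 : D.carrier ∩ ball (D.pt 0) R₀ = {z : ℂ | (D.pt 0).im < z.im} ∩ ball (D.pt 0) R₀)
    (Φ : ConformalEquiv D.carrier upperHalfPlaneSet)
    (hΦ0 : Tendsto (fun z => ‖Φ z‖) (𝓝[D.carrier] (D.pt 0)) atTop)
    (hΦ1 : Φ.HasBoundaryValue (D.pt 1) 0)
    {F : ℂ → ℂ} (hFd : DifferentiableOn ℂ F (ball (D.pt 1) R₁))
    (hFΦ : EqOn F Φ (D.carrier ∩ ball (D.pt 1) R₁)) (hFc : deriv F (D.pt 1) ≠ 0)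
    (P : ℕ → DobrushinDomain) (hPsub : ∀ n, (P n).carrier ⊆ D.carrier)
    (hPflat1 : ∀ n, (P n).carrier ∩ ball (D.pt 1) R₁ = {z : ℂ | (D.pt 1).im < z.im} ∩ ball (D.pt 1) R₁)
    (hPflat0 : ∀ n, (P n).carrier ∩ ball (D.pt 0) R₀ = {z : ℂ | (D.pt 0).im < z.im} ∩ ball (D.pt 0) R₀)
    (hK1 : ∀ K : Set ℂ, IsCompact K → K ⊆ D.carrier → ∀ᶠ n in atTop, K ⊆ (P n).carrier)
    (ΦP : ∀ n, ConformalEquiv (P n).carrier upperHalfPlaneSet)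
    {FP : ℕ → ℂ → ℂ} (hFPd : ∀ n, DifferentiableOn ℂ (FP n) (ball (D.pt 1) R₁))
    (hFPinj : ∀ n, InjOn (FP n) (ball (D.pt 1) R₁))
    (hFPΦ : ∀ n, EqOn (FP n) (ΦP n) ((P n).carrier ∩ ball (D.pt 1) R₁))
    (hFPb : ∀ n, FP n (D.pt 1) = 0)
    (hcP : ∀ n, 0 < (deriv (FP n) (D.pt 1)).re ∧ (deriv (FP n) (D.pt 1)).im = 0)
    {hP : ℕ → ℂ → ℂ} (hhPd : ∀ n, DifferentiableOn ℂ (hP n) (ball (D.pt 0) R₀))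
    (hhPinj : ∀ n, InjOn (hP n) (ball (D.pt 0) R₀)) (hhP0 : ∀ n, hP n (D.pt 0) = 0)
    (hhPΦ : ∀ n, ∀ z ∈ (P n).carrier ∩ ball (D.pt 0) R₀, hP n z * ΦP n z = 1)
    {m : ℕ → ℕ} (hm : StrictMono m) {Gl : ℂ → ℂ}
    (hGl : TendstoLocallyUniformlyOn (fun k z => FP (m k) z / deriv (FP (m k)) (D.pt 1)) Gl atTop
      (ball (D.pt 1) R₁)) :
    EqOn Gl (fun z => F z / deriv F (D.pt 1)) (ball (D.pt 1) R₁) := by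
  -- notation
  set b : ℂ := D.pt 1 with hbdef
  set a : ℂ := D.pt 0 with hadef
  set Bp : Set ℂ := {z : ℂ | b.im < z.im} ∩ ball b R₁ with hBpdef
  set B0p : Set ℂ := {z : ℂ | a.im < z.im} ∩ ball a R₀ with hB0pdef
  have hΩo : IsOpen D.carrier := D.isOpen
  have hΩc : IsPreconnected D.carrier := D.isConnected.isPreconnected
  have hacl : a ∈ closure D.carrier := frontier_subset_closure (D.pt_mem_frontier 0)
  have hbcl : b ∈ closure D.carrier := frontier_subset_closure (D.pt_mem_frontier 1)
  have hBpP : ∀ n, Bp ⊆ (P n).carrier := fun n => upperHalfDisc_subset_of_flat (hPflat1 n)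
  have hB0pP : ∀ n, B0p ⊆ (P n).carrier := fun n => upperHalfDisc_subset_of_flat (hPflat0 n)
  have hBpΩ : Bp ⊆ D.carrier := upperHalfDisc_subset_of_flat hflat1
  have hB0pΩ : B0p ⊆ D.carrier := upperHalfDisc_subset_of_flat hflat0
  obtain ⟨hBpo, hBpc⟩ := isOpen_isPreconnected_upperHalfDisc b R₁
  obtain ⟨hB0po, hB0pc⟩ := isOpen_isPreconnected_upperHalfDisc a R₀
  -- the normalising constants
  set c : ℕ → ℂ := fun k => deriv (FP (m k)) b with hcdef
  have hc : ∀ k, 0 < (c k).re ∧ (c k).im = 0 := fun k => hcP (m k)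
  have hcreal : ∀ k, c k = ((c k).re : ℂ) := fun k => Complex.ext (by simp) (by simp [(hc k).2])
  have hcne : ∀ k, c k ≠ 0 := fun k h => by
    have := (hc k).1; rw [h, zero_re] at this; exact lt_irrefl _ this
  have hmulH : ∀ k, ∀ w ∈ upperHalfPlaneSet, c k * w ∈ upperHalfPlaneSet := fun k w hw => by
    show 0 < (c k * w).im
    have : (c k * w).im = (c k).re * w.im := by rw [hcreal k]; simp
    rw [this]
    exact mul_pos (hc k).1 hw
  -- two points of the upper half-discs
  set z₁ : ℂ := b + ((R₁ / 2 : ℝ) : ℂ) * I with hz₁def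
  set z₁' : ℂ := b + ((R₁ / 4 : ℝ) : ℂ) * I with hz₁'def
  set z₂ : ℂ := a + ((R₀ / 2 : ℝ) : ℂ) * I with hz₂def
  have hz₁ : z₁ ∈ Bp := add_mul_I_mem_upperHalfDisc b (by positivity) (by linarith)
  have hz₁' : z₁' ∈ Bp := add_mul_I_mem_upperHalfDisc b (by positivity) (by linarith)
  have hz₂ : z₂ ∈ B0p := add_mul_I_mem_upperHalfDisc a (by positivity) (by linarith)
  have hne : z₁ ≠ z₁' := fun h => by
    have : ((R₁ / 2 : ℝ) : ℂ) * I = ((R₁ / 4 : ℝ) : ℂ) * I := add_left_cancel h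
    have := mul_right_cancel₀ I_ne_zero this
    rw [ofReal_inj] at this
    linarith
  -- Step 1: basic properties of the limit
  have hup : ∀ k, ∀ z ∈ Bp, 0 < (FP (m k) z).im := fun k z hz => by
    rw [hFPΦ (m k) ⟨hBpP _ hz, hz.2⟩]; exact (ΦP (m k)).mapsTo (hBpP _ hz)
  obtain ⟨hGld, hGlb, hGl1, hGlinj, hGlmaps, -⟩ := gateLimit_basic hR₁ (FP := fun k => FP (m k))
    (fun k => hFPd _) (fun k => hFPinj _) (fun k => hFPb _) hc hup hGl
  -- Step 2: the rescaled inverse frames and their limit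
  set ψ : ℕ → ℂ → ℂ := fun k w => (ΦP (m k)).symm (c k * w) with hψdef
  have hψd : ∀ k, DifferentiableOn ℂ (ψ k) upperHalfPlaneSet := fun k =>
    (ΦP (m k)).symm.differentiableOn_coe.comp (differentiableOn_id.const_mul _) (hmulH k)
  have hψm : ∀ k, MapsTo (ψ k) upperHalfPlaneSet D.carrier := fun k w hw =>
    hPsub _ ((ΦP (m k)).symm_mapsTo (hmulH k w hw))
  have hψinj : ∀ k, InjOn (ψ k) upperHalfPlaneSet := fun k w₁ hw₁ w₂ hw₂ heq =>
    mul_left_cancel₀ (hcne k) ((ΦP (m k)).symm.injOn (hmulH k _ hw₁) (hmulH k _ hw₂) heq)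
  have hGS : ∀ k, ∀ z ∈ Bp, FP (m k) z / c k ∈ upperHalfPlaneSet ∧ ψ k (FP (m k) z / c k) = z := by
    intro k z hz
    have hzP : z ∈ (P (m k)).carrier := hBpP _ hz
    have hFz : FP (m k) z = ΦP (m k) z := hFPΦ (m k) ⟨hzP, hz.2⟩
    refine ⟨?_, ?_⟩
    · show 0 < (FP (m k) z / c k).im
      rw [hcreal k, div_ofReal_im]
      exact div_pos (hup k z hz) (hc k).1
    · show (ΦP (m k)).symm (c k * (FP (m k) z / c k)) = z
      rw [mul_div_cancel₀ _ (hcne k), hFz, (ΦP (m k)).symm_apply_apply hzP]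
  have hGl' : TendstoLocallyUniformlyOn (fun k z => FP (m k) z / c k) Gl atTop Bp :=
    hGl.mono inter_subset_right
  obtain ⟨κ, ψl, hκ, hψld, hψlim, hleft, hψlinj, hψlcl⟩ := inverse_limit D.isBounded hz₁ hz₁' hne
    hψd hψm hψinj hGS hGl' hGlmaps
  -- Step 3: `ψ̃(ℍ) ⊆ D.carrier`
  have hI : I ∈ upperHalfPlaneSet := by show (0 : ℝ) < I.im; simp
  have h2I : 2 * I ∈ upperHalfPlaneSet := by show (0 : ℝ) < (2 * I).im; simp
  have hψlΩ : MapsTo ψl upperHalfPlaneSet D.carrier :=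
    mapsTo_carrier_of_mapsTo_closure D.toJordanDomain isOpen_upperHalfPlaneSet
      (convex_halfSpace_im_gt 0).isPreconnected hψld hψlinj hI h2I
      (fun h => by have := congrArg Complex.im h; norm_num at this) hψlcl
  -- Step 4: local limits of the rescaled frames
  set Hf : ℕ → ℂ → ℂ := fun i z => ΦP (m (κ i)) z / c (κ i) with hHfdef
  have hHfψ : ∀ i, ∀ z ∈ (P (m (κ i))).carrier, ψ (κ i) (Hf i z) = z := fun i z hz => by
    show (ΦP (m (κ i))).symm (c (κ i) * (ΦP (m (κ i)) z / c (κ i))) = z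
    rw [mul_div_cancel₀ _ (hcne _), (ΦP (m (κ i))).symm_apply_apply hz]
  have hHfd : ∀ i, DifferentiableOn ℂ (Hf i) (P (m (κ i))).carrier := fun i =>
    (ΦP (m (κ i))).differentiableOn_coe.div_const _
  have hHfm : ∀ i, MapsTo (Hf i) (P (m (κ i))).carrier upperHalfPlaneSet := fun i z hz => by
    show 0 < (ΦP (m (κ i)) z / c (κ i)).im
    rw [hcreal, div_ofReal_im]
    exact div_pos ((ΦP (m (κ i))).mapsTo hz) (hc _).1
  have hHfz₁ : Tendsto (fun i => Hf i z₁) atTop (𝓝 (Gl z₁)) := by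
    refine ((hGl'.tendsto_at hz₁).comp hκ.tendsto_atTop).congr fun i => ?_
    show FP (m (κ i)) z₁ / c (κ i) = ΦP (m (κ i)) z₁ / c (κ i)
    rw [hFPΦ (m (κ i)) ⟨hBpP _ hz₁, hz₁.2⟩]
  have hloc : ∀ V : Set ℂ, IsOpen V → IsPreconnected V → z₁ ∈ V → ∀ i₀ : ℕ,
      (∀ i, i₀ ≤ i → V ⊆ (P (m (κ i))).carrier) →
      ∃ (ι : ℕ → ℕ) (g : ℂ → ℂ), StrictMono ι ∧ DifferentiableOn ℂ g V ∧
        MapsTo g V upperHalfPlaneSet ∧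
        TendstoLocallyUniformlyOn (fun j => Hf (ι j + i₀)) g atTop V ∧ ∀ z ∈ V, ψl (g z) = z :=
    fun V hVo hVc hz₁V i₀ hVP => local_limit hψld hψlim hVo hVc
      (fun i hi => (hHfd i).mono (hVP i hi)) (fun i hi z hz => hHfm i (hVP i hi hz))
      (fun i hi z hz => hHfψ i z (hVP i hi hz)) hz₁V (hGlmaps hz₁) hHfz₁
  have hmκ : Tendsto (fun i => m (κ i)) atTop atTop := (hm.comp hκ).tendsto_atTop
  -- surjectivity of `ψ̃`
  have hsurj : SurjOn ψl upperHalfPlaneSet D.carrier := by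
    intro z₀ hz₀
    obtain ⟨W, hWo, hWc, hz₁W, hz₀W, hWcpt, hWΩ⟩ :=
      CaratheodoryKernel.exists_isPreconnected_open_closure_subset hΩo hΩc (hBpΩ hz₁) hz₀
    obtain ⟨i₀, hi₀⟩ := eventually_atTop.1 (hmκ.eventually (hK1 _ hWcpt hWΩ))
    obtain ⟨ι, g, -, -, hgm, -, hg⟩ := hloc W hWo hWc hz₁W i₀
      (fun i hi => subset_closure.trans (hi₀ i hi))
    exact ⟨g z₀, hgm hz₀W, hg z₀ hz₀W⟩
  -- Step 5: the conformal equivalence `Φ̃ = ψ̃⁻¹`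
  have hbij : BijOn ψl upperHalfPlaneSet D.carrier := ⟨hψlΩ, hψlinj, hsurj⟩
  have hderivne : ∀ w ∈ upperHalfPlaneSet, deriv ψl w ≠ 0 := fun w hw =>
    Literature.Analysis.Complex.SCV.deriv_ne_zero_of_injOn hψld isOpen_upperHalfPlaneSet hψlinj hw
  have hinvd : DifferentiableOn ℂ (invFunOn ψl upperHalfPlaneSet) D.carrier := by
    have := Complex.differentiableOn_invFunOn_image isOpen_upperHalfPlaneSet hψld hψlinj hderivne
    rwa [hbij.image_eq] at this
  set E : ConformalEquiv upperHalfPlaneSet D.carrier := ConformalEquiv.ofBijOn ψl hψld hbij hinvd with hEdef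
  set Φl : ConformalEquiv D.carrier upperHalfPlaneSet := E.symm with hΦldef
  have hΦlψ : ∀ z ∈ D.carrier, ψl (Φl z) = z := fun z hz => E.apply_symm_apply hz
  have hΦl_eq_of : ∀ z ∈ D.carrier, ∀ w ∈ upperHalfPlaneSet, ψl w = z → Φl z = w := fun z hz w hw h =>
    hψlinj (Φl.mapsTo hz) hw ((hΦlψ z hz).trans h.symm)
  have hΦlGl : ∀ z ∈ Bp, Φl z = Gl z := fun z hz =>
    hΦl_eq_of z (hBpΩ hz) (Gl z) (hGlmaps hz) (hleft z hz)
  -- Step 6: boundary values of `Φ̃`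
  have hΦl1 : Φl.HasBoundaryValue b 0 := by
    have h1 : Tendsto Gl (𝓝[D.carrier] b) (𝓝 0) := by
      have := (hGld.continuousOn.continuousAt (ball_mem_nhds b hR₁)).tendsto
      rw [hGlb] at this
      exact this.mono_left nhdsWithin_le_nhds
    refine h1.congr' ?_
    filter_upwards [self_mem_nhdsWithin, mem_nhdsWithin_of_mem_nhds (ball_mem_nhds b hR₁)]
      with z hz hzb
    have hzBp : z ∈ Bp := by rw [← hflat1]; exact ⟨hz, hzb⟩
    exact (hΦlGl z hzBp).symm
  have hΦl0 : Tendsto (fun z => ‖Φl z‖) (𝓝[D.carrier] a) atTop := by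
    obtain ⟨W, hWo, hWc, hz₁W, hz₂W, hWcpt, hWΩ⟩ :=
      CaratheodoryKernel.exists_isPreconnected_open_closure_subset hΩo hΩc (hBpΩ hz₁) (hB0pΩ hz₂)
    set V : Set ℂ := (Bp ∪ W) ∪ B0p with hVdef
    have hVo : IsOpen V := (hBpo.union hWo).union hB0po
    have hVc : IsPreconnected V :=
      (hBpc.union z₁ hz₁ hz₁W hWc).union z₂ (Or.inr hz₂W) hz₂ hB0pc
    have hVΩ : V ⊆ D.carrier := union_subset (union_subset hBpΩ (subset_closure.trans hWΩ)) hB0pΩ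
    obtain ⟨i₀, hi₀⟩ := eventually_atTop.1 (hmκ.eventually (hK1 _ hWcpt hWΩ))
    have hVP : ∀ i, i₀ ≤ i → V ⊆ (P (m (κ i))).carrier := fun i hi =>
      union_subset (union_subset (hBpP _) (subset_closure.trans (hi₀ i hi))) (hB0pP _)
    obtain ⟨ι, g, -, -, hgm, hglim, hg⟩ := hloc V hVo hVc (Or.inl (Or.inl hz₁)) i₀ hVP
    have hgΦl : EqOn g Φl B0p := fun z hz =>
      (hΦl_eq_of z (hB0pΩ hz) (g z) (hgm (Or.inr hz)) (hg z (Or.inr hz))).symm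
    have hlimB0 : TendstoLocallyUniformlyOn (fun j => Hf (ι j + i₀)) Φl atTop B0p :=
      (hglim.mono subset_union_right).congr_right hgΦl
    -- the univalent reciprocals at the root
    set hh : ℕ → ℂ → ℂ := fun j z => c (κ (ι j + i₀)) * hP (m (κ (ι j + i₀))) z with hhhdef
    have hhd : ∀ j, DifferentiableOn ℂ (hh j) (ball a R₀) := fun j => (hhPd _).const_mul _
    have hhinj : ∀ j, InjOn (hh j) (ball a R₀) := fun j z₁ hz₁ z₂ hz₂ heq =>
      hhPinj _ hz₁ hz₂ (mul_left_cancel₀ (hcne _) heq)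
    have hh0 : ∀ j, hh j a = 0 := fun j => by simp [hhhdef, hhP0]
    have hhH : ∀ j, ∀ z ∈ B0p, hh j z * Hf (ι j + i₀) z = 1 := fun j z hz => by
      show c (κ (ι j + i₀)) * hP (m (κ (ι j + i₀))) z *
        (ΦP (m (κ (ι j + i₀))) z / c (κ (ι j + i₀))) = 1
      have h := hhPΦ (m (κ (ι j + i₀))) z ⟨hB0pP _ hz, hz.2⟩
      have h' : c (κ (ι j + i₀)) * hP (m (κ (ι j + i₀))) z *
          (ΦP (m (κ (ι j + i₀))) z / c (κ (ι j + i₀))) =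
          hP (m (κ (ι j + i₀))) z * ΦP (m (κ (ι j + i₀))) z *
            (c (κ (ι j + i₀)) / c (κ (ι j + i₀))) := by ring
      rw [h', h, div_self (hcne _), one_mul]
    have hΦlc : ContinuousOn Φl B0p := (Φl.continuousOn).mono hB0pΩ
    have hΦl0' : ∀ z ∈ B0p, (Φl : ℂ → ℂ) z ≠ 0 := fun z hz h => by
      have : (0 : ℝ) < ((Φl : ℂ → ℂ) z).im := Φl.mapsTo (hB0pΩ hz)
      rw [h, zero_im] at this
      exact lt_irrefl _ this
    have key := tendsto_norm_atTop_of_univalent_reciprocal hR₀ hhd hhinj hh0 hhH hΦlc hΦl0' hlimB0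
    have hnhds : 𝓝[D.carrier] a = 𝓝[B0p] a := by
      rw [nhdsWithin_restrict' D.carrier (ball_mem_nhds a hR₀), hflat0]
    rw [hnhds]
    exact key
  -- Step 7: identification with the frame of `D.carrier`
  obtain ⟨lam, hlam, hEq⟩ := Identification.uniformiser_unique hacl hbcl Φ Φl hΦ0 hΦ1 hΦl0 hΦl1
  have hGlF : EqOn Gl (fun z => (lam : ℂ) * F z) (ball b R₁) := by
    have h1 : AnalyticOnNhd ℂ Gl (ball b R₁) := hGld.analyticOnNhd isOpen_ball
    have h2 : AnalyticOnNhd ℂ (fun z => (lam : ℂ) * F z) (ball b R₁) :=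
      (hFd.const_mul _).analyticOnNhd isOpen_ball
    refine h1.eqOn_of_preconnected_of_eventuallyEq h2 (convex_ball b R₁).isPreconnected hz₁.2 ?_
    filter_upwards [hBpo.mem_nhds hz₁] with z hz
    rw [← hΦlGl z hz, hEq (hBpΩ hz), hFΦ ⟨hBpΩ hz, hz.2⟩]
  have hlamF : (lam : ℂ) * deriv F b = 1 := by
    have hev : Gl =ᶠ[𝓝 b] fun z => (lam : ℂ) * F z :=
      Filter.eventuallyEq_of_mem (ball_mem_nhds b hR₁) hGlF
    have h := hev.deriv_eq
    rw [hGl1, deriv_const_mul _ (hFd.differentiableAt (ball_mem_nhds b hR₁))] at h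
    exact h.symm
  intro z hz
  rw [hGlF hz]
  show (lam : ℂ) * F z = F z / deriv F b
  rw [eq_div_iff hFc, mul_comm, ← mul_assoc, mul_comm (deriv F b), hlamF, one_mul]

/-! ### Registered form -/

/-- **Registered helper `gateStability_kernelLimit`** (∀-closed form of `kernel_limit_eq`; sub-goal
of stub `stub_gateStability`, crux stmt-CriticalPhenomena-14004, line `polygon-parity-squeeze`):
every kernel limit of the normalised gate reflections of inner frames is the normalised gate
reflection of the frame of `Ω`. [cite: PommerenkeBBCM1992, Thm. 1.8] -/
theorem gateStability_kernelLimit : ∀ (D : DobrushinDomain) (R₁ R₀ : ℝ), 0 < R₁ → 0 < R₀ → D.carrier ∩ Metric.ball (D.pt 1) R₁ = {z : ℂ | (D.pt 1).im < z.im} ∩ Metric.ball (D.pt 1) R₁ → D.carrier ∩ Metric.ball (D.pt 0) R₀ = {z : ℂ | (D.pt 0).im < z.im} ∩ Metric.ball (D.pt 0) R₀ → ∀ (Φ : ConformalEquiv D.carrier UpperHalfPlane.upperHalfPlaneSet), Filter.Tendsto (fun z => ‖Φ z‖) (𝓝[D.carrier] (D.pt 0)) Filter.atTop → Φ.HasBoundaryValue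 (D.pt 1) 0 → ∀ (F : ℂ → ℂ), DifferentiableOn ℂ F (Metric.ball (D.pt 1) R₁) → Set.EqOn F Φ (D.carrier ∩ Metric.ball (D.pt 1) R₁) → deriv F (D.pt 1) ≠ 0 → ∀ (P : ℕ → DobrushinDomain), (∀ n, (P n).carrier ⊆ D.carrier) → (∀ n, (P n).carrier ∩ Metric.ball (D.pt 1) R₁ = {z : ℂ | (D.pt 1).im < z.im} ∩ Metric.ball (D.pt 1) R₁) → (∀ n, (P n).carrier ∩ Metric.ball (D.pt 0) R₀ = {z : ℂ | (D.pt 0).im < z.im} ∩ Metric.ball (D.pt 0) R₀) → (∀ K : Set ℂ, IsCompact K → K ⊆ D.carrier → ∀ᶠ n in Filter.atTop, K ⊆ (P n).carrier) → ∀ (ΦP : (n : ℕ) → ConformalEquiv (P n).carrier UpperHalfPlane.upperHalfPlaneSet) (FP : ℕ → ℂ → ℂ), (∀ n, DifferentiableOn ℂ (FP n) (Metric.ball (D.pt 1) R₁)) → (∀ n, Set.InjOn (FP n) (Metric.ball (D.pt 1) R₁)) → (∀ n, Set.EqOn (FP n) (ΦP n) ((P n).carrier ∩ Metric.ball (D.pt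 1) R₁)) → (∀ n, FP n (D.pt 1) = 0) → (∀ n, 0 < (deriv (FP n) (D.pt 1)).re ∧ (deriv (FP n) (D.pt 1)).im = 0) → ∀ (hP : ℕ → ℂ → ℂ), (∀ n, DifferentiableOn ℂ (hP n) (Metric.ball (D.pt 0) R₀)) → (∀ n, Set.InjOn (hP n) (Metric.ball (D.pt 0) R₀)) → (∀ n, hP n (D.pt 0) = 0) → (∀ n, ∀ z ∈ (P n).carrier ∩ Metric.ball (D.pt 0) R₀, hP n z * ΦP n z = 1) → ∀ (m : ℕ → ℕ), StrictMono m → ∀ (Gl : ℂ → ℂ), TendstoLocallyUniformlyOn (fun k z => FP (m k) z / deriv (FP (m k)) (D.pt 1)) Gl Filter.atTop (Metric.ball (D.pt 1) R₁) → Set.EqOn Gl (fun z => F z / deriv F (D.pt 1)) (Metric.ball (D.pt 1) R₁) :=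
  fun D _ _ hR₁ hR₀ hflat1 hflat0 Φ hΦ0 hΦ1 _ hFd hFΦ hFc P hPsub hPflat1 hPflat0 hK1 ΦP _ hFPd hFPinj
      hFPΦ hFPb hcP _ hhPd hhPinj hhP0 hhPΦ _ hm _ hGl =>
    kernel_limit_eq D hR₁ hR₀ hflat1 hflat0 Φ hΦ0 hΦ1 hFd hFΦ hFc P hPsub hPflat1 hPflat0 hK1 ΦP hFPd
      hFPinj hFPΦ hFPb hcP hhPd hhPinj hhP0 hhPΦ hm hGl

end Summit.CriticalPhenomena.SAWScalingLimit.Theorems.PolygonParitySqueeze.GateStability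

end
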